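import Mathlib
import HarnessLib
import Summits.MatrixMultiplication.MatrixMultiplication.Theorems.OutsiderSandwichToricCeiling
import Summits.MatrixMultiplication.MatrixMultiplication.Theorems.OutsiderSandwichToricUniqueness

/-!
# OutsiderSandwich — the toric ceiling of `cw₂^{⊠2}` in the PERMUTATION basis is `6`, not `7`
(decomp-mm lens 4, gen 44, kernel K44-2; THESES-FREE, `ω`-free; helper toward `LaserTangency`,
stmt-32268 — extremal subrank/packing cells of the literal host `kroneckerPow (cwTensor ℂ 2) N`)

WHAT.  `…ToricCeiling` (K43-1) proved that in BOTH `N = 2` product bases of `cw₂^{⊠2}` no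
diagonal with `≥ 8` triples is a combinatorial degeneration (Strassen / Bürgisser–Clausen–Shokrollahi
(15.29)) and that `7` IS attained in the Coppersmith–Winograd basis (`cwFrame_toric_value`).  Here,
for the permutation ("tight") basis `D ⊠ D` (`tightFrame`, `36` triples):

* `tightFrame_no_diagonal_comb_degeneration_seven`: NO diagonal with `≥ 7` triples is a
  combinatorial degeneration (weights in any linearly ordered commutative ring);
* `tightFrame_diagonal_comb_degeneration_six`: the explicit diagonal `psiSix` of `6` triples IS one
  (integer weights in `[-2, 3]`), so
* `tightFrame_toric_value`: the toric (combinatorial-degeneration) subrank of `cw₂^{⊠2}` in the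
  permutation basis is EXACTLY `6` — strictly below the cw-basis value `7`.  The toric value of a
  Kronecker power depends on the product basis, and `3^N - 2` is NOT attained in the all-permutation
  basis already at `N = 2`: the first rung of the conjectured all-`N` sharpening `≤ 3^N - 3` of
  `…ToricCeilingPow.productFrame_no_diagonal_comb_degeneration` (memo NODE-g44, decomp-mm lens 4).

THE ARGUMENT (uniqueness, K43-5).  A toric diagonal is the UNIQUE perfect 3-dimensional matching of
its own vertex sets inside the frame (`…ToricUniqueness.matching_eq`).  A size-`7` diagonal of the
tight frame misses two points on each leg, and the letter-count law (`cnt_tight`: per coordinate,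
every letter sits on exactly one leg of a tight triple) forces every letter to occur exactly twice
per coordinate among the six missing points (`adm_of_seven`).  The kernel then evaluates the finite
fact `two_matchings`: for EVERY admissible triple of missing pairs (`900` of the `36³` cases) the
structural enumerator `pms` lists two perfect matchings of the complementary vertex sets inside the
tight frame which the list-level CHECKER `goodL` re-verifies (frame membership, leg-injectivity,
the three leg images) and `differs` separates — the enumerator is checked, not trusted.  Two
matchings contradict uniqueness.
-/

set_option linter.dupNamespace false

namespace Summit.MatrixMultiplication.MatrixMultiplication.Theorems.OutsiderSandwichToricCeilingTightSeven

open Finset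
open Summit.MatrixMultiplication.MatrixMultiplication.Theorems.OutsiderSandwichToricCeiling
  (Pt Tr dSlot tightFrame isDiagonal cnt₁ cnt₂ cnt_tight injOn_of_isDiagonal sum_ite_eq_card_image
    tightFrame_no_diagonal_comb_degeneration_eight)
open Summit.MatrixMultiplication.MatrixMultiplication.Theorems.OutsiderSandwichToricUniqueness
  (matching_eq)

/-! ## §1 List-level primitives (kernel-evaluable) -/

/-- The nine points of a leg, listed. [new] -/
def ptList : List Pt := [(0,0),(0,1),(0,2),(1,0),(1,1),(1,2),(2,0),(2,1),(2,2)]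

/-- Boolean list membership for points. [new] -/
def memB (p : Pt) : List Pt → Bool
  | [] => false
  | q :: l => decide (p = q) || memB p l

/-- Boolean list membership for triples. [new] -/
def memT (t : Tr) : List Tr → Bool
  | [] => false
  | s :: l => decide (t = s) || memT t l

/-- Boolean duplicate-freeness. [new] -/
def nodupB : List Pt → Bool
  | [] => true
  | p :: l => !memB p l && nodupB l

/-- Every element of `l₁` occurs in `l₂`. [new] -/
def subB (l₁ l₂ : List Pt) : Bool := l₁.all fun p => memB p l₂

/-- How many points of `l` carry the letter `α` under the coordinate `f`. [new] -/
def lcount (f : Pt → Fin 3) (α : Fin 3) : List Pt → ℕ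
  | [] => 0
  | p :: l => (if f p = α then 1 else 0) + lcount f α l

/-- ADMISSIBLE six missing points: every letter exactly twice in each coordinate. [new] -/
def admL (l : List Pt) : Bool :=
  (lcount (fun p => p.1) 0 l == 2) && (lcount (fun p => p.2) 0 l == 2) &&
    (lcount (fun p => p.1) 1 l == 2) && (lcount (fun p => p.2) 1 l == 2) &&
    (lcount (fun p => p.1) 2 l == 2) && (lcount (fun p => p.2) 2 l == 2)

/-- The four tight-frame triples through the A-point `u`: `(u, u - δ, u + δ)`, `δ ∈ {1,2}²`. [new] -/
def trisAt (u : Pt) : List Tr :=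
  [((1 : Fin 3), (1 : Fin 3)), (1, 2), (2, 1), (2, 2)].map fun d =>
    (u, ((u.1 - d.1, u.2 - d.2) : Pt), ((u.1 + d.1, u.2 + d.2) : Pt))

/-- All perfect matchings (as lists of triples) of the A-points `us` inside the tight frame whose
B-points avoid `vs` and whose C-points avoid `ws` (structural recursion on `us`). [new] -/
def pms : List Pt → List Pt → List Pt → List (List Tr)
  | [], _, _ => [[]]
  | u :: us, vs, ws =>
      (trisAt u).flatMap fun t =>
        if memB t.2.1 vs || memB t.2.2 ws then []
        else (pms us (t.2.1 :: vs) (t.2.2 :: ws)).map (t :: ·)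

/-- The points of a leg outside `l`. [new] -/
def coL (l : List Pt) : List Pt := ptList.filter fun p => !memB p l

/-- Candidate matchings of the vertex sets complementary to the missing points. [new] -/
def witL (xs ys zs : List Pt) : List (List Tr) := pms (coL xs) ys zs

/-- CHECKER: `P` lies in the tight frame, is injective on every leg, and its three leg images are
exactly the points outside `xs`, `ys`, `zs`. [new] -/
def goodL (xs ys zs : List Pt) (P : List Tr) : Bool :=
  P.all (fun t => dSlot t.1.1 t.2.1.1 t.2.2.1 && dSlot t.1.2 t.2.1.2 t.2.2.2) &&
    nodupB (P.map fun t => t.1) && nodupB (P.map fun t => t.2.1) &&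
    nodupB (P.map fun t => t.2.2) &&
    subB (P.map fun t => t.1) (coL xs) && subB (coL xs) (P.map fun t => t.1) &&
    subB (P.map fun t => t.2.1) (coL ys) && subB (coL ys) (P.map fun t => t.2.1) &&
    subB (P.map fun t => t.2.2) (coL zs) && subB (coL zs) (P.map fun t => t.2.2)

/-- Some triple of `P₁` is not a triple of `P₂`. [new] -/
def differs (P₁ P₂ : List Tr) : Bool := P₁.any fun t => !memT t P₂

/-- A linear code for points (to list each two-point set once). [new] -/
def enc (p : Pt) : ℕ := 3 * p.1.val + p.2.val

/-- The `36` two-point subsets of a leg, each listed once as an ordered pair. [new] -/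
def pairL : List (Pt × Pt) :=
  ptList.flatMap fun p => (ptList.filter fun q => enc p < enc q).map fun q => (p, q)

/-! ## §2 The finite fact (kernel `decide`) -/

set_option maxRecDepth 100000

set_option maxHeartbeats 4000000 in
/-- For every admissible choice of missing pairs, the complementary vertex sets carry two distinct
checked perfect matchings inside the tight frame (`900` admissible cases of `36³`). [new] -/
theorem two_matchings : ∀ xx ∈ pairL, ∀ yy ∈ pairL, ∀ zz ∈ pairL,
    admL [xx.1, xx.2, yy.1, yy.2, zz.1, zz.2] = true →
    ∃ P₁ ∈ witL [xx.1, xx.2] [yy.1, yy.2] [zz.1, zz.2],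
      ∃ P₂ ∈ witL [xx.1, xx.2] [yy.1, yy.2] [zz.1, zz.2], differs P₁ P₂ = true ∧
        goodL [xx.1, xx.2] [yy.1, yy.2] [zz.1, zz.2] P₁ = true ∧
        goodL [xx.1, xx.2] [yy.1, yy.2] [zz.1, zz.2] P₂ = true := by
  decide +kernel

/-- Every two-point set is listed in `pairL`. [new] -/
theorem exists_pairL : ∀ p q : Pt, p ≠ q →
    ∃ xx ∈ pairL, (p = xx.1 ∧ q = xx.2) ∨ (p = xx.2 ∧ q = xx.1) := by
  decide

/-- `ptList` lists every point. [new] -/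
theorem mem_ptList : ∀ p : Pt, p ∈ ptList := by decide

/-- Each letter labels exactly three points of a leg in each coordinate. [folklore] -/
theorem card_fibre : ∀ α : Fin 3,
    #{p ∈ (univ : Finset Pt) | p.1 = α} = 3 ∧ #{p ∈ (univ : Finset Pt) | p.2 = α} = 3 := by decide

/-! ## §3 Semantics of the list-level primitives -/

/-- `memB` decides list membership. [folklore] -/
theorem memB_iff (p : Pt) (l : List Pt) : memB p l = true ↔ p ∈ l := by
  induction l with
  | nil => simp [memB]
  | cons q l ih => simp [memB, ih]

/-- `memT` decides list membership. [folklore] -/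
theorem memT_iff (t : Tr) (l : List Tr) : memT t l = true ↔ t ∈ l := by
  induction l with
  | nil => simp [memT]
  | cons s l ih => simp [memT, ih]

/-- `nodupB` decides duplicate-freeness. [folklore] -/
theorem nodupB_iff (l : List Pt) : nodupB l = true ↔ l.Nodup := by
  induction l with
  | nil => simp [nodupB]
  | cons p l ih =>
    have h : (!memB p l) = true ↔ p ∉ l := by
      rw [Bool.not_eq_true', ← Bool.not_eq_true, memB_iff]
    simp [nodupB, ih, h, List.nodup_cons]

/-- `subB` decides inclusion of the underlying sets. [folklore] -/
theorem subB_iff (l₁ l₂ : List Pt) : subB l₁ l₂ = true ↔ ∀ p ∈ l₁, p ∈ l₂ := by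
  simp [subB, List.all_eq_true, memB_iff]

/-- `coL l` lists exactly the points outside `l`. [folklore] -/
theorem mem_coL (l : List Pt) (p : Pt) : p ∈ coL l ↔ p ∉ l := by
  have h : (!memB p l) = true ↔ p ∉ l := by
    rw [Bool.not_eq_true', ← Bool.not_eq_true, memB_iff]
  simp [coL, List.mem_filter, mem_ptList, h]

/-- `differs` separates the underlying finsets. [folklore] -/
theorem differs_imp {P₁ P₂ : List Tr} (h : differs P₁ P₂ = true) : P₁.toFinset ≠ P₂.toFinset := by
  intro e
  obtain ⟨t, ht, hnot⟩ := List.any_eq_true.mp h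
  have : t ∈ P₂ := by
    rw [← List.mem_toFinset, ← e, List.mem_toFinset]; exact ht
  rw [← memT_iff] at this
  simp [this] at hnot

/-- Leg-injectivity from duplicate-free leg lists. [folklore] -/
theorem injOn_of_nodupB {P : List Tr} {g : Tr → Pt} (h : nodupB (P.map g) = true) :
    Set.InjOn g P.toFinset := by
  rw [nodupB_iff] at h
  intro t ht t' ht' e
  simp only [Finset.mem_coe, List.mem_toFinset] at ht ht'
  exact List.inj_on_of_nodup_map h ht ht' e

/-- Leg image from the two-sided inclusion check. [folklore] -/
theorem image_eq_of_subB {P : List Tr} {g : Tr → Pt} {xs : List Pt}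
    (h₁ : subB (P.map g) (coL xs) = true) (h₂ : subB (coL xs) (P.map g) = true) :
    P.toFinset.image g = univ \ xs.toFinset := by
  rw [subB_iff] at h₁ h₂
  ext p
  simp only [Finset.mem_image, List.mem_toFinset, Finset.mem_sdiff, Finset.mem_univ, true_and]
  constructor
  · rintro ⟨t, ht, rfl⟩
    exact (mem_coL xs (g t)).mp (h₁ (g t) (List.mem_map.mpr ⟨t, ht, rfl⟩))
  · intro hp
    obtain ⟨t, ht, e⟩ := List.mem_map.mp (h₂ p ((mem_coL xs p).mpr hp))
    exact ⟨t, ht, e⟩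

/-! ## §4 From a size-7 diagonal to an admissible complement -/

/-- Removing a point set lowers a coordinate fibre by its letter count. [folklore] -/
theorem card_sdiff_fibre (S : Finset Pt) (P : Pt → Prop) [DecidablePred P] :
    #{p ∈ univ \ S | P p} + #{p ∈ S | P p} = #{p ∈ (univ : Finset Pt) | P p} := by
  have h : {p ∈ univ \ S | P p} = {p ∈ (univ : Finset Pt) | P p} \ {p ∈ S | P p} := by
    ext p
    simp only [Finset.mem_filter, Finset.mem_sdiff, Finset.mem_univ, true_and, not_and]
    tauto
  rw [h]
  exact Finset.card_sdiff_add_card_eq_card (fun p hp => by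
    simp only [Finset.mem_filter, Finset.mem_univ, true_and] at hp ⊢; exact hp.2)

/-- Letter count of a two-point set. [folklore] -/
theorem card_filter_pair {x₁ x₂ : Pt} (h : x₁ ≠ x₂) (P : Pt → Prop) [DecidablePred P] :
    #{p ∈ ({x₁, x₂} : Finset Pt) | P p} = (if P x₁ then 1 else 0) + (if P x₂ then 1 else 0) := by
  rw [Finset.filter_insert, Finset.filter_singleton]
  by_cases h₁ : P x₁ <;> by_cases h₂ : P x₂ <;> simp [h₁, h₂, h]

variable {R : Type*} [CommRing R]

/-- THE LETTER-COUNT LAW at `N = 2`, tight frame, co-size `2`: if a size-`7` diagonal misses the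
points `x₁ ≠ x₂`, `y₁ ≠ y₂`, `z₁ ≠ z₂` on the three legs, then every letter occurs exactly twice
per coordinate among them. [new] -/
theorem adm_of_seven {Ψ : Finset Tr} (hsub : Ψ ⊆ tightFrame) (hdiag : isDiagonal Ψ = true)
    (h7 : #Ψ = 7) {x₁ x₂ y₁ y₂ z₁ z₂ : Pt} (hx : x₁ ≠ x₂) (hy : y₁ ≠ y₂) (hz : z₁ ≠ z₂)
    (iX : univ \ Ψ.image (fun t : Tr => t.1) = {x₁, x₂})
    (iY : univ \ Ψ.image (fun t : Tr => t.2.1) = {y₁, y₂})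
    (iZ : univ \ Ψ.image (fun t : Tr => t.2.2) = {z₁, z₂}) :
    admL [x₁, x₂, y₁, y₂, z₁, z₂] = true := by
  obtain ⟨j₁, j₂, j₃⟩ := injOn_of_isDiagonal hdiag
  have key : ∀ (P : Pt → Prop) [DecidablePred P], #{p ∈ (univ : Finset Pt) | P p} = 3 →
      (∀ t ∈ Ψ, (if P t.1 then 1 else 0) + (if P t.2.1 then 1 else 0) +
        (if P t.2.2 then 1 else 0) = 1) →
      (if P x₁ then 1 else 0) + (if P x₂ then 1 else 0) + ((if P y₁ then 1 else 0) +
        (if P y₂ then 1 else 0)) + ((if P z₁ then 1 else 0) + (if P z₂ then 1 else 0)) = 2 := by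
    intro P _ h3 hΨ
    have s : ∑ t ∈ Ψ, ((if P t.1 then 1 else 0) + (if P t.2.1 then 1 else 0) +
        (if P t.2.2 then 1 else 0)) = 7 := by
      rw [Finset.sum_congr rfl hΨ, Finset.sum_const, h7]; rfl
    simp only [Finset.sum_add_distrib] at s
    rw [sum_ite_eq_card_image j₁ P, sum_ite_eq_card_image j₂ P, sum_ite_eq_card_image j₃ P] at s
    have a₁ := card_sdiff_fibre (Ψ.image (fun t : Tr => t.1)) P
    have a₂ := card_sdiff_fibre (Ψ.image (fun t : Tr => t.2.1)) P
    have a₃ := card_sdiff_fibre (Ψ.image (fun t : Tr => t.2.2)) P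
    rw [iX, card_filter_pair hx] at a₁
    rw [iY, card_filter_pair hy] at a₂
    rw [iZ, card_filter_pair hz] at a₃
    omega
  have c₁ : ∀ α : Fin 3, (if x₁.1 = α then 1 else 0) + (if x₂.1 = α then 1 else 0) +
      ((if y₁.1 = α then 1 else 0) + (if y₂.1 = α then 1 else 0)) +
      ((if z₁.1 = α then 1 else 0) + (if z₂.1 = α then 1 else 0)) = 2 := fun α =>
    key (fun p => p.1 = α) (card_fibre α).1 (fun t ht => (cnt_tight t (hsub ht) α).1)
  have c₂ : ∀ α : Fin 3, (if x₁.2 = α then 1 else 0) + (if x₂.2 = α then 1 else 0) +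
      ((if y₁.2 = α then 1 else 0) + (if y₂.2 = α then 1 else 0)) +
      ((if z₁.2 = α then 1 else 0) + (if z₂.2 = α then 1 else 0)) = 2 := fun α =>
    key (fun p => p.2 = α) (card_fibre α).2 (fun t ht => (cnt_tight t (hsub ht) α).2)
  have d₀ := c₁ 0; have d₁ := c₁ 1; have d₂ := c₁ 2
  have e₀ := c₂ 0; have e₁ := c₂ 1; have e₂ := c₂ 2
  simp only [admL, lcount, Bool.and_eq_true, beq_iff_eq]
  omega

/-! ## §5 The ceiling `≤ 6` -/

/-- Membership in the tight frame is the slot condition in both coordinates. [folklore] -/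
theorem mem_tightFrame {t : Tr} :
    t ∈ tightFrame ↔ dSlot t.1.1 t.2.1.1 t.2.2.1 = true ∧ dSlot t.1.2 t.2.1.2 t.2.2.2 = true := by
  simp [tightFrame]

/-- What the checker certifies: a leg-injective subset of the tight frame with prescribed leg
images. [new] -/
theorem goodL_sound {xs ys zs : List Pt} {P : List Tr} (h : goodL xs ys zs P = true) :
    P.toFinset ⊆ tightFrame ∧
    Set.InjOn (fun t : Tr => t.1) P.toFinset ∧ Set.InjOn (fun t : Tr => t.2.1) P.toFinset ∧
    Set.InjOn (fun t : Tr => t.2.2) P.toFinset ∧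
    P.toFinset.image (fun t : Tr => t.1) = univ \ xs.toFinset ∧
    P.toFinset.image (fun t : Tr => t.2.1) = univ \ ys.toFinset ∧
    P.toFinset.image (fun t : Tr => t.2.2) = univ \ zs.toFinset := by
  simp only [goodL, Bool.and_eq_true] at h
  obtain ⟨⟨⟨⟨⟨⟨⟨⟨⟨hslot, n₁⟩, n₂⟩, n₃⟩, s₁⟩, s₁'⟩, s₂⟩, s₂'⟩, s₃⟩, s₃'⟩ := h
  refine ⟨fun t ht => ?_, injOn_of_nodupB n₁, injOn_of_nodupB n₂, injOn_of_nodupB n₃,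
    image_eq_of_subB s₁ s₁', image_eq_of_subB s₂ s₂', image_eq_of_subB s₃ s₃'⟩
  have := List.all_eq_true.mp hslot t (List.mem_toFinset.mp ht)
  rw [Bool.and_eq_true] at this
  exact mem_tightFrame.mpr this

/-- **Toric ceiling, permutation basis, sharpened.**  In the tight frame `D ⊠ D` of `cw₂^{⊠2}` no
diagonal with at least `7` triples is a combinatorial degeneration (weights in any linearly ordered
commutative ring). [new] -/
theorem tightFrame_no_diagonal_comb_degeneration_seven [LinearOrder R] [IsStrictOrderedRing R]
    {Ψ : Finset Tr} {a b c : Pt → R}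
    (hsub : Ψ ⊆ tightFrame) (hzero : ∀ t ∈ Ψ, a t.1 + b t.2.1 + c t.2.2 = 0)
    (hone : ∀ t ∈ tightFrame, t ∉ Ψ → 1 ≤ a t.1 + b t.2.1 + c t.2.2)
    (hdiag : isDiagonal Ψ = true) (h7 : 7 ≤ #Ψ) : False := by
  by_cases h8 : 8 ≤ #Ψ
  · exact tightFrame_no_diagonal_comb_degeneration_eight hsub hzero hone hdiag h8
  have hc : #Ψ = 7 := by omega
  obtain ⟨j₁, j₂, j₃⟩ := injOn_of_isDiagonal hdiag
  have hPt : Fintype.card Pt = 9 := by simp [Fintype.card_prod, Fintype.card_fin]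
  have cardX : ∀ {g : Tr → Pt}, Set.InjOn g Ψ → #(univ \ Ψ.image g) = 2 := fun hg => by
    rw [Finset.card_univ_sdiff, Finset.card_image_of_injOn hg, hPt, hc]
  obtain ⟨x₁, x₂, hx, iX⟩ := Finset.card_eq_two.mp (cardX j₁)
  obtain ⟨y₁, y₂, hy, iY⟩ := Finset.card_eq_two.mp (cardX j₂)
  obtain ⟨z₁, z₂, hz, iZ⟩ := Finset.card_eq_two.mp (cardX j₃)
  -- orient the three pairs as listed in `pairL`
  have orient : ∀ {g : Tr → Pt} {p q : Pt}, p ≠ q → univ \ Ψ.image g = {p, q} →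
      ∃ xx ∈ pairL, xx.1 ≠ xx.2 ∧ univ \ Ψ.image g = {xx.1, xx.2} := by
    intro g p q hpq e
    obtain ⟨xx, hxx, h⟩ := exists_pairL p q hpq
    rcases h with ⟨rfl, rfl⟩ | ⟨rfl, rfl⟩
    · exact ⟨xx, hxx, hpq, e⟩
    · exact ⟨xx, hxx, hpq.symm, e.trans (Finset.pair_comm _ _)⟩
  obtain ⟨xx, hxx, hx', eX⟩ := orient hx iX
  obtain ⟨yy, hyy, hy', eY⟩ := orient hy iY
  obtain ⟨zz, hzz, hz', eZ⟩ := orient hz iZ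
  obtain ⟨P₁, -, P₂, -, hne, g₁, g₂⟩ := two_matchings xx hxx yy hyy zz hzz
    (adm_of_seven hsub hdiag hc hx' hy' hz' eX eY eZ)
  have pairF : ∀ p q : Pt, [p, q].toFinset = ({p, q} : Finset Pt) := fun p q => by simp
  have key : ∀ P : List Tr, goodL [xx.1, xx.2] [yy.1, yy.2] [zz.1, zz.2] P = true →
      P.toFinset = Ψ := by
    intro P hg
    obtain ⟨hPΦ, k₁, k₂, k₃, i₁, i₂, i₃⟩ := goodL_sound hg
    rw [pairF] at i₁ i₂ i₃
    rw [← eX, Finset.sdiff_sdiff_eq_self (Finset.subset_univ _)] at i₁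
    rw [← eY, Finset.sdiff_sdiff_eq_self (Finset.subset_univ _)] at i₂
    rw [← eZ, Finset.sdiff_sdiff_eq_self (Finset.subset_univ _)] at i₃
    exact matching_eq hzero hone hPΦ k₁ k₂ k₃ j₁ j₂ j₃ i₁ i₂ i₃
  exact differs_imp hne ((key P₁ g₁).trans (key P₂ g₂).symm)

/-! ## §6 Sharpness: a FREE size-6 diagonal, and the toric value `6` -/

/-- A size-6 diagonal of the tight frame which is FREE (an induced matching: no other tight triple
has all three legs among its vertex sets); its missing point sets are the three parallel lines
`p.1 + p.2 = 2, 0, 1` on legs A, B, C. [new] -/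
def psiSix : Finset Tr :=
  {((0,0), (2,2), (1,1)), ((1,0), (0,2), (2,1)), ((0,1), (2,0), (1,2)), ((2,1), (1,0), (0,2)),
    ((1,2), (0,1), (2,0)), ((2,2), (1,1), (0,0))}

/-- Leg-1 weights: the indicator of the missing A-line `p.1 + p.2 = 2`. [new] -/
def aSix : Pt → ℤ := fun p => if p.1 + p.2 = 2 then 1 else 0

/-- Leg-2 weights: the indicator of the missing B-line `p.1 + p.2 = 0`. [new] -/
def bSix : Pt → ℤ := fun p => if p.1 + p.2 = 0 then 1 else 0

/-- Leg-3 weights: the indicator of the missing C-line `p.1 + p.2 = 1`. [new] -/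
def cSix : Pt → ℤ := fun p => if p.1 + p.2 = 1 then 1 else 0

/-- **The tight-frame ceiling `6` is attained**: `psiSix` with the indicator weights of its missing
lines is a size-6 diagonal combinatorial degeneration of the tight frame (freeness makes the
zeroing-out certificate work: every other tight triple meets a missing line). [new] -/
theorem tightFrame_diagonal_comb_degeneration_six :
    psiSix ⊆ tightFrame ∧ (∀ t ∈ psiSix, aSix t.1 + bSix t.2.1 + cSix t.2.2 = 0) ∧
      (∀ t ∈ tightFrame, t ∉ psiSix → 1 ≤ aSix t.1 + bSix t.2.1 + cSix t.2.2) ∧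
      isDiagonal psiSix = true ∧ #psiSix = 6 := by
  refine ⟨by decide +kernel, by decide +kernel, by decide +kernel, by decide +kernel, by decide +kernel⟩

/-- **The toric value of the tight frame is exactly `6`** (vs. `7` for the cw frame,
`…ToricCeiling.cwFrame_toric_value`): a size-6 diagonal combinatorial degeneration of `D ⊠ D`
exists and none of size `≥ 7` does (integer weights, as in BCS (15.29)). [new] -/
theorem tightFrame_toric_value :
    (∃ Ψ : Finset Tr, ∃ a b c : Pt → ℤ, Ψ ⊆ tightFrame ∧ (∀ t ∈ Ψ, a t.1 + b t.2.1 + c t.2.2 = 0) ∧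
      (∀ t ∈ tightFrame, t ∉ Ψ → 1 ≤ a t.1 + b t.2.1 + c t.2.2) ∧ isDiagonal Ψ = true ∧ #Ψ = 6) ∧
    ¬ (∃ Ψ : Finset Tr, ∃ a b c : Pt → ℤ, Ψ ⊆ tightFrame ∧ (∀ t ∈ Ψ, a t.1 + b t.2.1 + c t.2.2 = 0) ∧
      (∀ t ∈ tightFrame, t ∉ Ψ → 1 ≤ a t.1 + b t.2.1 + c t.2.2) ∧ isDiagonal Ψ = true ∧ 7 ≤ #Ψ) :=
  ⟨⟨psiSix, aSix, bSix, cSix, tightFrame_diagonal_comb_degeneration_six⟩,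
    fun ⟨_, _, _, _, hsub, hzero, hone, hdiag, h7⟩ =>
      tightFrame_no_diagonal_comb_degeneration_seven hsub hzero hone hdiag h7⟩

end Summit.MatrixMultiplication.MatrixMultiplication.Theorems.OutsiderSandwichToricCeilingTightSeven
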